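import Summits.AnomalousDissipation.AnomalousDissipation.Theorems.SolenoidalFractalHomogenisationLagrangianStepWEvenCertSlotsB
import Summits.AnomalousDissipation.AnomalousDissipation.Theorems.SolenoidalFractalHomogenisationLagrangianStepCellLawVQSPairMemory
import Summits.AnomalousDissipation.AnomalousDissipation.Theorems.SolenoidalFractalHomogenisationLagrangianStepD1Split
import HarnessLib

/-!
# D1 residue certificate (CERT-(i) v0, variant A) — part 1/3: the pair-memory tensor and the comparison forms

K1L_D item stmt-AnomalousDissipation-27980 (registered stub `stub_D1_exactFamily`, `…WCrossingWindow`); design memo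
`Cruxes/LagrangianRenormalisationStep/Lines/onelevel-D1-residue-cert.md` (planner ad-ideate-p5 g13, kit j322277/j322297).

The colinear adjacent-pair memory tensor `pairQS S` of the 26-slot cubature word (local model definition: slots `2l, 2l+1` share `m, τ`;
`R_T(B) = T∫₀¹a(s)∫₀¹a(x)e^{−T(1+s−x)B}dxds` sandwiched by `P_m̂`, weight `slotCoef_{2l}`, symmetrised polarisations), the class tables
`nC = (93/10⁶, 36/10⁸, 16/10⁹)` (`≥ ½T_cK(T_c·10/11)²`), `lC = (2911, 2937, 2938)/10⁴` (`≤ 0.97·f_{T_c}(11/10)`), the certified constant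
`ρP = 115/10⁶`, and the two comparison forms `N̄(k,p) = Σ_j c_j(e_j·k)² nC_j |P_j p|²`, `L̄(k,p) = Σ_j c_j(e_j·k)² lC_j |P_j p|²`.
Parts 2/3 (`…D1ResidueCertPair`: `bsymb (pairQS S)² ≤ N̄N̄`) and 3/3 (`…D1ResidueCert`: `L̄ ≤ symb (excQS S)`, `N̄ ≤ ρP L̄`,
`relSmall_pairQS`, `clause_i_of_tail`) complete the certificate.
Port note (prover ad-k1loc-p3 g8, CERT-(i)-LAND, ruling D26-9): texts verbatim from the crux spine v3 (sha12 7c5da58463df) and planner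
ad-ideate-p5's pre-cut port; the AM-GM pair weight `pairW` is placed here (not in part 2/3) so that parts 2/3 and 3/3 are definition-free.
-/

set_option linter.dupNamespace false

namespace Summit.AnomalousDissipation.AnomalousDissipation.Theorems.SolenoidalFractalHomogenisation.LagrangianStep.D1ResidueCert

open Summit.AnomalousDissipation.AnomalousDissipation.Theorems
open Summit.AnomalousDissipation.AnomalousDissipation.Theorems.SolenoidalFractalHomogenisation.LagrangianStep
open Summit.AnomalousDissipation.AnomalousDissipation.Theorems.SolenoidalFractalHomogenisation.LagrangianStep.WCrossing
open Summit.AnomalousDissipation.AnomalousDissipation.Theorems.SolenoidalFractalHomogenisation.LagrangianStep.WEvenCert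
open Literature.Analysis Literature.Analysis.FluidPDE Literature.Analysis.FunctionSpaces
open Set Real

noncomputable section

/-! ## §1 The pair-memory tensor of the cubature word (local model definitions) -/

/-- Slot time `T_s = 4π²|m_s|²·M_B·τ_s` (`= T100, T110, T111` by class). -/
def slotT (j : Fin 26) : ℝ :=
  4 * Real.pi ^ 2 * ‖Torus.latticeVec (cubatureWord.phase j).m‖ ^ 2 * MB * (cubatureWord.phase j).τ

/-- The PAIR-MEMORY response matrix `R_T(B) = T ∫₀¹ a(s) ∫₀¹ a(x) e^{−T(1+s−x)B} dx ds` (`= T·J_T(B)²` by the symmetry of the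
trapezoid; the matrix of p1's `pairForm`, cf. `abs_pairForm_le`). -/
def pairResp (ρ T : ℝ) (B : Matrix (Fin 3) (Fin 3) ℝ) : Matrix (Fin 3) (Fin 3) ℝ := fun i j =>
  T * ∫ s in (0:ℝ)..1, LatticeShear.LatticeWord.trapezoid 0 1 ρ s *
    ∫ x in (0:ℝ)..1, LatticeShear.LatticeWord.trapezoid 0 1 ρ x * (NormedSpace.exp (-((T * (1 + s - x)) • B))) i j

/-- The projected pair response of slot `j` at background `S`: `P_j · R_{T_j}(B̂_j(S)) · P_j`. -/
def pairQ (S : T4) (j : Fin 26) : Matrix (Fin 3) (Fin 3) ℝ :=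
  projPerp (mhat (cubatureWord.phase j)) * pairResp cubatureWord.ramp (slotT j) (regBlock S (mhat (cubatureWord.phase j))) *
    projPerp (mhat (cubatureWord.phase j))

/-- First slot `2l` of the `l`-th colinear adjacent pair of the cubature word. -/
def fstSlot (l : Fin 13) : Fin 26 := ⟨2 * l.val, by have := l.isLt; omega⟩

/-- Second slot `2l+1` of the `l`-th colinear adjacent pair (same `m`, same `τ`, orthogonal polarisation). -/
def sndSlot (l : Fin 13) : Fin 26 := ⟨2 * l.val + 1, by have := l.isLt; omega⟩

/-- THE PAIR-MEMORY TENSOR `pairQS S = Σ_{l<13} slotCoef_{2l} · sym(e_{2l} ⊗ e_{2l+1}) ⊗ (P R P)_{2l}(S)` — the `O(e^{0})` cross-slot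
memory of the 13 colinear adjacent pairs (all other pairs are `≤ e^{−T·10/11} ≤ 10⁻¹²`, part of the tail). Index convention of `excQS`:
`(a,b)` carry the polarisations, `(i,j)` the response. -/
def pairQS (S : T4) : T4 := fun i a j b =>
  ∑ l : Fin 13, slotCoef cubatureWord (fstSlot l) *
    (((cubatureWord.phase (fstSlot l)).e a * (cubatureWord.phase (sndSlot l)).e b +
      (cubatureWord.phase (sndSlot l)).e a * (cubatureWord.phase (fstSlot l)).e b) / 2) * pairQ S (fstSlot l) i j

/-! ## §2 Class constants and the two comparison forms `N̄`, `L` -/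

/-- Class table lookup by `M = |m|² ∈ {1,2,3}` (`Mq_cases`). -/
def byClass (X1 X2 X3 M : ℝ) : ℝ := if M = 1 then X1 else if M = 2 then X2 else X3

/-- Upper class constants `n_c ≥ ½ T_c K(T_c·10/11)²` (true values 9.2950e-5, 3.5458e-7, 1.5355e-8; kit j322277). -/
def nC (j : Fin 26) : ℝ := byClass (93 / 1000000) (36 / 100000000) (16 / 1000000000) (Mq (slots j))

/-- Lower class constants `l_c ≤ (97/100)·f_{T_c}(11/10)` — the denominator of record is the LANDED first-order sectorial pinch
`OddGain.evenPinch_excQS_design_point'` (`0.97·gainForm(11/10)/(11/10) ≤ symb (excQS S)`, charge 3 %); true values 0.2912693,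
0.2938690, 0.2939306.  (The S2 second-order route — scalar pinch + `oddEven_qsResp`, charge 0.34 % — would allow
`lC = (299/10³, 3019/10⁴, 3019/10⁴)` and `ρP` down to `111/10⁶`; not needed at `ρB = 3/25000`, memo §2 D2/D2′.) -/
def lC (j : Fin 26) : ℝ := byClass (2911 / 10000) (2937 / 10000) (2938 / 10000) (Mq (slots j))

/-- The certified residue constant of the pair term: `ρP = 115/10⁶` (`< ρB = 120/10⁶`, tail allowance `ρB − ρP = 5/10⁶`; smallest
certifiable with these tables `≈ 1.1394/10⁴`, with the S2 tables `≈ 1.1092/10⁴`). -/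
def ρP : ℝ := 115 / 1000000

/-- `k`-side slot factor `e_j · k`. -/
def ek (j : Fin 26) (k : Fin 3 → ℝ) : ℝ := ∑ a, (cubatureWord.phase j).e a * k a

/-- `p`-side slot factor `|P_j p|²` (`= |p|² − (p·m̂_j)²`, `sum_sq_projPerp_mulVec`). -/
def PpSq (j : Fin 26) (p : Fin 3 → ℝ) : ℝ := ∑ i, ((projPerp (mhat (cubatureWord.phase j))).mulVec p i) ^ 2

/-- NUMERATOR comparison form `N̄(k,p) = Σ_j slotCoef_j (e_j·k)² · n_{c(j)} |P_j p|²`. -/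
def Nbar (k p : Fin 3 → ℝ) : ℝ := ∑ j, slotCoef cubatureWord j * ek j k ^ 2 * (nC j * PpSq j p)

/-- DENOMINATOR comparison form `L(k,p) = Σ_j slotCoef_j (e_j·k)² · l_{c(j)} |P_j p|²`. -/
def Lbar (k p : Fin 3 → ℝ) : ℝ := ∑ j, slotCoef cubatureWord j * ek j k ^ 2 * (lC j * PpSq j p)

/-- `nC > 0`. -/
theorem nC_pos (j : Fin 26) : 0 < nC j := by
  unfold nC byClass; split_ifs <;> norm_num

/-- `lC > 0`. -/
theorem lC_pos (j : Fin 26) : 0 < lC j := by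
  unfold lC byClass; split_ifs <;> norm_num

/-- `|P_j p|² = PpM/M` in the integer slot vocabulary of `WEvenCertDefs`. -/
theorem PpSq_eq (j : Fin 26) (p : Fin 3 → ℝ) : PpSq j p = PpM (slots j) p / Mq (slots j) := by
  unfold PpSq
  rw [show projPerp (mhat (cubatureWord.phase j)) = projPerp (nj j) from rfl, sum_sq_projPerp_mulVec (hn_j j) p]
  exact perp_sq j p

/-- The class table divided by `M` is the Lagrange interpolant of `(X1, X2/2, X3/3)` on `M ∈ {1,2,3}`. -/
theorem byClass_mul_PpSq (X1 X2 X3 : ℝ) (j : Fin 26) (p : Fin 3 → ℝ) :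
    byClass X1 X2 X3 (Mq (slots j)) * PpSq j p = qLag X1 (X2 / 2) (X3 / 3) (Mq (slots j)) * PpM (slots j) p := by
  rw [PpSq_eq]; unfold byClass qLag
  rcases Mq_cases j with h | h | h <;> rw [h] <;> norm_num <;> ring

/-- `|P_j p|² ≥ 0`. -/
theorem PpSq_nonneg (j : Fin 26) (p : Fin 3 → ℝ) : 0 ≤ PpSq j p := by
  unfold PpSq; exact Finset.sum_nonneg fun i _ => sq_nonneg _

/-- `N̄ ≥ 0`. -/
theorem Nbar_nonneg (k p : Fin 3 → ℝ) : 0 ≤ Nbar k p :=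
  Finset.sum_nonneg fun j _ =>
    mul_nonneg (mul_nonneg (slotCoef_nonneg cubatureWord j) (sq_nonneg _)) (mul_nonneg (nC_pos j).le (PpSq_nonneg j p))

/-- `L̄ ≥ 0`. -/
theorem Lbar_nonneg (k p : Fin 3 → ℝ) : 0 ≤ Lbar k p :=
  Finset.sum_nonneg fun j _ =>
    mul_nonneg (mul_nonneg (slotCoef_nonneg cubatureWord j) (sq_nonneg _)) (mul_nonneg (lC_pos j).le (PpSq_nonneg j p))

/-- The two rational SIGN CONDITIONS of the O_h-reduced core (`β ≥ 0` at `t = 0`, `α + β ≥ 0` at `t = ½`), with `e_c = ρP·l_c − n_c`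
(values `+1.91·10⁻³`, `+1.02·10⁻⁴`). -/
theorem signConditions :
    0 ≤ 40 * (ρP * (2911 / 10000) - 93 / 1000000) + 80 * (ρP * (2937 / 10000) - 36 / 100000000)
          + 48 * (ρP * (2938 / 10000) - 16 / 1000000000) ∧
    0 ≤ 120 * (ρP * (2911 / 10000) - 93 / 1000000) + 144 * (ρP * (2937 / 10000) - 36 / 100000000)
          + 72 * (ρP * (2938 / 10000) - 16 / 1000000000) := by
  unfold ρP; constructor <;> norm_num

/-! ## §3 The AM-GM pair weight (used by part 2/3) -/

/-- The pair weight `W_l(k) = c_{2l}·((e_{2l}·k)² + (e_{2l+1}·k)²)·nC_{2l}` of the AM-GM step. -/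
def pairW (k : Fin 3 → ℝ) (l : Fin 13) : ℝ :=
  slotCoef cubatureWord (fstSlot l) * (ek (fstSlot l) k ^ 2 + ek (sndSlot l) k ^ 2) * nC (fstSlot l)

/-- `W_l ≥ 0`. -/
theorem pairW_nonneg (k : Fin 3 → ℝ) (l : Fin 13) : 0 ≤ pairW k l :=
  mul_nonneg (mul_nonneg (slotCoef_nonneg _ _) (add_nonneg (sq_nonneg _) (sq_nonneg _))) (nC_pos _).le

end

end Summit.AnomalousDissipation.AnomalousDissipation.Theorems.SolenoidalFractalHomogenisation.LagrangianStep.D1ResidueCert
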